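import Mathlib.FieldTheory.KummerExtension
import Mathlib.NumberTheory.KummerDedekind

/-!
# T5QuadraticKummerDedekind — the quadratic case of Kummer–Dedekind:
# «`I` stays prime in `S` ⟺ `d` is not a square modulo `I`»

Tier-5 kernel support (seat p8, blind lane; sub-step N3, the census of the inert places).
The record sorts the finite places `v` of the totally real field `F` by their behaviour in the
CM field `E = F(√d)`; the inert ones are those with `d` a non-square modulo `v`.  This file
puts the general statement behind that sentence in kernel form, in Mathlib's abstract
Kummer–Dedekind setting (`R ⊆ S`, `x ∈ S` integral with `minpoly R x = X² − d`, `I` a maximal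
ideal of `R` coprime to the conductor of `R[x]`):

* `irreducible_X_sq_sub_C_iff` — over a field, `X² − a` is irreducible iff `a` is not a square
  (Mathlib's `X_pow_sub_C_irreducible_iff_of_prime` at the prime `2`);
* `isPrime_map_of_not_isSquare` — `d` not a square mod `I` ⇒ `I S` is prime (the first half
  of Mathlib's Kummer–Dedekind theorem, `KummerDedekind.Ideal.irreducible_map_of_irreducible_minpoly`,
  and «irreducible ⇒ prime» in the Dedekind domain `S`);
* `not_isSquare_of_isPrime_map` — `I S` prime ⇒ `d` not a square mod `I` (Mathlib's ring
  isomorphism `S ⧸ I S ≃+* (R ⧸ I)[X] ⧸ (X² − d̄)`, `KummerDedekind.quotMapEquivQuotQuotMap`: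
  a domain quotient forces `X² − d̄` prime, hence irreducible);
* `isPrime_map_iff_not_isSquare` — the criterion.

No `sorry`, no axiom beyond `propext`, `Classical.choice`, `Quot.sound`; Mathlib only.
-/

namespace Summit.Ventures.HodgeRepro2.T5QuadraticKummerDedekind

open Polynomial

section Field

variable {k : Type*} [Field k]

/-- Over a field, `X ^ 2 - C a` is irreducible iff `a` is not a square. -/
theorem irreducible_X_sq_sub_C_iff (a : k) : Irreducible (X ^ 2 - C a) ↔ ¬ IsSquare a := by
  rw [X_pow_sub_C_irreducible_iff_of_prime Nat.prime_two]
  constructor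
  · rintro h ⟨b, rfl⟩
    exact h b (by ring)
  · intro h b hb
    exact h ⟨b, by rw [← hb]; ring⟩

/-- `a` is a square iff `X ^ 2 - C a` has a root. -/
theorem isSquare_iff_exists_sq_eq (a : k) : IsSquare a ↔ ∃ b : k, b ^ 2 = a := by
  constructor
  · rintro ⟨b, rfl⟩
    exact ⟨b, by ring⟩
  · rintro ⟨b, rfl⟩
    exact ⟨b, by ring⟩

end Field

section KummerDedekind

variable {R S : Type*} [CommRing R] [CommRing S] [Algebra R S] [IsDomain R] [IsIntegrallyClosed R]
  [IsDedekindDomain S] [Module.IsTorsionFree R S] {x : S} {I : Ideal R} {d : R}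

omit [IsDomain R] [IsIntegrallyClosed R] [IsDedekindDomain S] [Module.IsTorsionFree R S] in
/-- The reduction of `minpoly R x = X ^ 2 - C d` modulo `I`. -/
theorem map_minpoly_eq (hmin : minpoly R x = X ^ 2 - C d) :
    (minpoly R x).map (Ideal.Quotient.mk I) = X ^ 2 - C (Ideal.Quotient.mk I d) := by
  rw [hmin, Polynomial.map_sub, Polynomial.map_pow, Polynomial.map_X, Polynomial.map_C]

omit [IsIntegrallyClosed R] in
/-- `I S ≠ ⊥` when `I ≠ ⊥` (the algebra map `R → S` is injective). -/
theorem map_ne_bot (hI' : I ≠ ⊥) : I.map (algebraMap R S) ≠ ⊥ := by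
  rwa [Ne, Ideal.map_eq_bot_iff_of_injective (FaithfulSMul.algebraMap_injective R S)]

/-- **Kummer–Dedekind, quadratic case, inert direction**: if `d` is not a square modulo the
maximal ideal `I` (coprime to the conductor of `R[x]`, `minpoly R x = X ^ 2 - C d`), then
`I S` is a prime ideal of `S` — «`I` stays prime». -/
theorem isPrime_map_of_not_isSquare (hI : I.IsMaximal) (hI' : I ≠ ⊥)
    (hx : (conductor R x).comap (algebraMap R S) ⊔ I = ⊤) (hx' : IsIntegral R x)
    (hmin : minpoly R x = X ^ 2 - C d) (hd : ¬ IsSquare (Ideal.Quotient.mk I d)) :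
    (I.map (algebraMap R S)).IsPrime := by
  have hirr : Irreducible ((minpoly R x).map (Ideal.Quotient.mk I)) := by
    haveI : I.IsMaximal := hI
    letI := Ideal.Quotient.field I
    rw [map_minpoly_eq hmin]
    exact (irreducible_X_sq_sub_C_iff _).mpr hd
  have hirrI := KummerDedekind.Ideal.irreducible_map_of_irreducible_minpoly hI hI' hx hx' hirr
  exact (Ideal.prime_iff_isPrime (map_ne_bot hI')).mp
    (UniqueFactorizationMonoid.irreducible_iff_prime.mp hirrI)

/-- **Kummer–Dedekind, quadratic case, converse**: if `I S` is prime then `d` is not a square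
modulo `I`: through Mathlib's `S ⧸ I S ≃+* (R ⧸ I)[X] ⧸ (X ^ 2 - C d̄)` the quotient
`(R ⧸ I)[X] ⧸ (X ^ 2 - C d̄)` is a domain, so `X ^ 2 - C d̄` is prime, hence irreducible, hence
`d̄` is not a square. -/
theorem not_isSquare_of_isPrime_map (hI : I.IsMaximal)
    (hx : (conductor R x).comap (algebraMap R S) ⊔ I = ⊤) (hx' : IsIntegral R x)
    (hmin : minpoly R x = X ^ 2 - C d) (hP : (I.map (algebraMap R S)).IsPrime) :
    ¬ IsSquare (Ideal.Quotient.mk I d) := by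
  haveI : I.IsMaximal := hI
  letI := Ideal.Quotient.field I
  haveI : IsDomain (S ⧸ I.map (algebraMap R S)) := Ideal.Quotient.isDomain _
  have e := KummerDedekind.quotMapEquivQuotQuotMap (x := x) hx hx'
  haveI : IsDomain ((R ⧸ I)[X] ⧸ Ideal.span {(minpoly R x).map (Ideal.Quotient.mk I)}) :=
    MulEquiv.isDomain _ e.symm.toMulEquiv
  have hprime : (Ideal.span {(minpoly R x).map (Ideal.Quotient.mk I)}).IsPrime :=
    (Ideal.Quotient.isDomain_iff_prime _).mp this
  have hne : (minpoly R x).map (Ideal.Quotient.mk I) ≠ 0 :=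
    Polynomial.map_monic_ne_zero (minpoly.monic hx')
  have hp : Prime ((minpoly R x).map (Ideal.Quotient.mk I)) :=
    (Ideal.span_singleton_prime hne).mp hprime
  have hirr := hp.irreducible
  rw [map_minpoly_eq hmin] at hirr
  exact (irreducible_X_sq_sub_C_iff _).mp hirr

/-- **The quadratic Kummer–Dedekind criterion**: for `minpoly R x = X ^ 2 - C d` and a maximal
`I ≠ ⊥` coprime to the conductor of `R[x]`, `I S` is prime iff `d` is not a square modulo `I`. -/
theorem isPrime_map_iff_not_isSquare (hI : I.IsMaximal) (hI' : I ≠ ⊥)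
    (hx : (conductor R x).comap (algebraMap R S) ⊔ I = ⊤) (hx' : IsIntegral R x)
    (hmin : minpoly R x = X ^ 2 - C d) :
    (I.map (algebraMap R S)).IsPrime ↔ ¬ IsSquare (Ideal.Quotient.mk I d) :=
  ⟨not_isSquare_of_isPrime_map hI hx hx' hmin, isPrime_map_of_not_isSquare hI hI' hx hx' hmin⟩

/-- The criterion, read on the quotient `S ⧸ I S`: it is a domain iff `d` is not a square
modulo `I`. -/
theorem isDomain_quotient_map_iff_not_isSquare (hI : I.IsMaximal) (hI' : I ≠ ⊥)
    (hx : (conductor R x).comap (algebraMap R S) ⊔ I = ⊤) (hx' : IsIntegral R x)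
    (hmin : minpoly R x = X ^ 2 - C d) :
    IsDomain (S ⧸ I.map (algebraMap R S)) ↔ ¬ IsSquare (Ideal.Quotient.mk I d) := by
  rw [Ideal.Quotient.isDomain_iff_prime]
  exact isPrime_map_iff_not_isSquare hI hI' hx hx' hmin

end KummerDedekind

end Summit.Ventures.HodgeRepro2.T5QuadraticKummerDedekind
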